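import Summits.Langlands.Langlands.Statement
import HarnessLib

/-!
# Stub `stub_potentialAutomorphyCM` of line `pieces` is implied by item stmt-Langlands-14091
# (crux `ReciprocityTRCM`, stmt-Langlands-1093; `--supports` helper)

Support file (closes nothing).  The registered stub `stub_potentialAutomorphyCM` (potential weak automorphy
of irreducible geometric `ρ` over CM fields, for EVERY reciprocity datum `R` carrying (A) in every rank) is the
CM-restricted, `∀ 𝓡` form of item stmt-Langlands-14091 `LiftDescend.PotentialAutomorphy` (all number fields,
`∃ 𝓡`-pinned).  The implication 14091 ⇒ stub is recorded here VERBATIM in both signatures, so that the stub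
closes the moment the item does.  The only point: `IsGeometricFramed R ρ` does not depend on `R` — the
`p`-adic Hodge datum `ReciprocityData.pst` is PINNED (D-0018 L2: it ignores `𝓡` and returns Fontaine's
`fontainePstAdicCompletion v ℓ hv`), so the geometricity hypothesis for the given `R` is definitionally the
one for the datum `R'` produced by the item, and the item's conclusion does not mention the datum at all.
No definitions; standard axioms.

## References
* T. Barnet-Lamb, T. Gee, D. Geraghty, R. Taylor, *Potential automorphy and change of weight*,
  Ann. of Math. 179 (2014), Thm. 4.5.1. [BarnetlambEtAl2014]
-/

noncomputable section

set_option linter.dupNamespace false -- project-wide option (lakefile weak.linter.dupNamespace); `Summit.Langlands.Langlands` is the mandated namespace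

open scoped MatrixGroups NumberField
open NumberField IsDedekindDomain Filter
open Literature.NumberTheory.Automorphic Literature.NumberTheory.GaloisRepresentations
open Summit.Langlands

namespace Summit.Langlands.Langlands.Theorems.ReciprocityTRCM

/-- **Geometricity is datum-independent**: `IsGeometricFramed R ρ ↔ IsGeometricFramed R' ρ` — the pinned
`p`-adic Hodge datum `ReciprocityData.pst` ignores the reciprocity datum (definitional). [folklore] -/
theorem isGeometricFramed_iff_of_reciprocityData {K : Type} [Field K] [NumberField K] {n : ℕ} {ℓ : ℕ}
    [Fact ℓ.Prime] (R R' : ReciprocityData K) (ρ : FramedGaloisRep K (PadicAlgCl ℓ) n) :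
    IsGeometricFramed R ρ ↔ IsGeometricFramed R' ρ :=
  Iff.rfl

/-- **Item stmt-Langlands-14091 ⇒ stub `stub_potentialAutomorphyCM`** (both verbatim): given a CM field `F`
and a datum `R` with (A) in every rank, the item (applied to `⟨R, (A)⟩`) yields a datum `R'` and potential
weak automorphy of every irreducible `R'`-geometric `ρ`; `R`-geometric = `R'`-geometric (pinned `pst`).
[cite: BarnetlambEtAl2014, Thm. 4.5.1] -/
theorem stub_potentialAutomorphyCM_of_potentialAutomorphy
    (h : ∀ (F : Type) [Field F] [NumberField F], (∃ R₀ : ReciprocityData F, ∀ n : ℕ, 0 < n → ∀ hcpt : Literature.NumberTheory.Automorphic.isCompact_glFiniteIntegralLevel n F, AutomorphicToGalois n R₀ hcpt) → ∃ R : ReciprocityData F, (∀ n : ℕ, 0 < n → ∀ hcpt : Literature.NumberTheory.Automorphic.isCompact_glFiniteIntegralLevel n F, AutomorphicToGalois n R hcpt) ∧ ∀ (n : ℕ), 0 < n → ∀ (ℓ : ℕ) [Fact ℓ.Prime] (ι : PadicAlgCl ℓ ≃+* ℂ) (ρ : Literature.NumberTheory.GaloisRepresentations.FramedGaloisRep F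 (PadicAlgCl ℓ) n), ρ.toGaloisRep.IsIrreducible → IsGeometricFramed R ρ → ∃ (F' : Type) (_ : Field F') (_ : NumberField F') (_ : Algebra F F') (_ : IsGalois F F'), (ρ.restrictField F').toGaloisRep.IsIrreducible ∧ ∃ (hcpt' : Literature.NumberTheory.Automorphic.isCompact_glFiniteIntegralLevel n F') (π' : Literature.NumberTheory.Automorphic.CuspidalAutomorphicRepData n F' hcpt'), π'.1.IsLAlgebraic ∧ ∀ᶠ w : IsDedekindDomain.HeightOneSpectrum (NumberField.RingOfIntegers F') in cofinite, SatakeFrobCompatibleAt ι π'.1 (ρ.restrictField F') w) :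
    ∀ (F : Type) [Field F] [NumberField F], NumberField.IsCMField F → ∀ R : ReciprocityData F, (∀ n : ℕ, 0 < n → ∀ hcpt : Literature.NumberTheory.Automorphic.isCompact_glFiniteIntegralLevel n F, AutomorphicToGalois n R hcpt) → ∀ (n : ℕ), 0 < n → ∀ (ℓ : ℕ) [Fact ℓ.Prime] (ι : PadicAlgCl ℓ ≃+* ℂ) (ρ : Literature.NumberTheory.GaloisRepresentations.FramedGaloisRep F (PadicAlgCl ℓ) n), ρ.toGaloisRep.IsIrreducible → IsGeometricFramed R ρ → ∃ (F' : Type) (_ : Field F') (_ : NumberField F') (_ : Algebra F F') (_ : IsGalois F F'), (ρ.restrictField F').toGaloisRep.IsIrreducible ∧ ∃ (hcpt' : Literature.NumberTheory.Automorphic.isCompact_glFiniteIntegralLevel n F') (π' : Literature.NumberTheory.Automorphic.CuspidalAutomorphicRepData n F' hcpt'), π'.1.IsLAlgebraic ∧ ∀ᶠ w : IsDedekindDomain.HeightOneSpectrum (NumberField.RingOfIntegers F') in cofinite, SatakeFrobCompatibleAt ι π'.1 (ρ.restrictField F') w := by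
  intro F _ _ _hF R hA n hn ℓ _ ι ρ hirr hgeo
  obtain ⟨R', -, hPA⟩ := h F ⟨R, hA⟩
  exact hPA n hn ℓ ι ρ hirr ((isGeometricFramed_iff_of_reciprocityData R R' ρ).1 hgeo)

/-- **The CM-restricted item suffices**: the same implication from item stmt-Langlands-14091 asserted only
over CM fields. [cite: BarnetlambEtAl2014, Thm. 4.5.1] -/
theorem stub_potentialAutomorphyCM_of_potentialAutomorphy_CM
    (h : ∀ (F : Type) [Field F] [NumberField F], NumberField.IsCMField F → (∃ R₀ : ReciprocityData F, ∀ n : ℕ, 0 < n → ∀ hcpt : Literature.NumberTheory.Automorphic.isCompact_glFiniteIntegralLevel n F, AutomorphicToGalois n R₀ hcpt) → ∃ R : ReciprocityData F, (∀ n : ℕ, 0 < n → ∀ hcpt : Literature.NumberTheory.Automorphic.isCompact_glFiniteIntegralLevel n F, AutomorphicToGalois n R hcpt) ∧ ∀ (n : ℕ), 0 < n → ∀ (ℓ : ℕ) [Fact ℓ.Prime] (ι : PadicAlgCl ℓ ≃+* ℂ) (ρ : Literature.NumberTheory.GaloisRepresentations.FramedGaloisRep F (PadicAlgCl ℓ)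 n), ρ.toGaloisRep.IsIrreducible → IsGeometricFramed R ρ → ∃ (F' : Type) (_ : Field F') (_ : NumberField F') (_ : Algebra F F') (_ : IsGalois F F'), (ρ.restrictField F').toGaloisRep.IsIrreducible ∧ ∃ (hcpt' : Literature.NumberTheory.Automorphic.isCompact_glFiniteIntegralLevel n F') (π' : Literature.NumberTheory.Automorphic.CuspidalAutomorphicRepData n F' hcpt'), π'.1.IsLAlgebraic ∧ ∀ᶠ w : IsDedekindDomain.HeightOneSpectrum (NumberField.RingOfIntegers F') in cofinite, SatakeFrobCompatibleAt ι π'.1 (ρ.restrictField F') w) :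
    ∀ (F : Type) [Field F] [NumberField F], NumberField.IsCMField F → ∀ R : ReciprocityData F, (∀ n : ℕ, 0 < n → ∀ hcpt : Literature.NumberTheory.Automorphic.isCompact_glFiniteIntegralLevel n F, AutomorphicToGalois n R hcpt) → ∀ (n : ℕ), 0 < n → ∀ (ℓ : ℕ) [Fact ℓ.Prime] (ι : PadicAlgCl ℓ ≃+* ℂ) (ρ : Literature.NumberTheory.GaloisRepresentations.FramedGaloisRep F (PadicAlgCl ℓ) n), ρ.toGaloisRep.IsIrreducible → IsGeometricFramed R ρ → ∃ (F' : Type) (_ : Field F') (_ : NumberField F') (_ : Algebra F F') (_ : IsGalois F F'), (ρ.restrictField F').toGaloisRep.IsIrreducible ∧ ∃ (hcpt' : Literature.NumberTheory.Automorphic.isCompact_glFiniteIntegralLevel n F') (π' : Literature.NumberTheory.Automorphic.CuspidalAutomorphicRepData n F' hcpt'), π'.1.IsLAlgebraic ∧ ∀ᶠ w : IsDedekindDomain.HeightOneSpectrum (NumberField.RingOfIntegers F') in cofinite, SatakeFrobCompatibleAt ι π'.1 (ρ.restrictField F') w := by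
  intro F _ _ hF R hA n hn ℓ _ ι ρ hirr hgeo
  obtain ⟨R', -, hPA⟩ := h F hF ⟨R, hA⟩
  exact hPA n hn ℓ ι ρ hirr ((isGeometricFramed_iff_of_reciprocityData R R' ρ).1 hgeo)

end Summit.Langlands.Langlands.Theorems.ReciprocityTRCM

end
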